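import Mathlib
import HarnessLib
import Summits.Ventures.LatticeQCDFlow.Exactness.NCMCGeneralSpaceReplicaPooledMeanCentring
import Summits.Ventures.LatticeQCDFlow.Exactness.NCMCGeneralSpaceReplicaPooledGammaCoverage
import Summits.Ventures.LatticeQCDFlow.Exactness.NCMCGeneralSpaceIndicatorCLT
import Summits.Ventures.LatticeQCDFlow.Scoring.DeltaMethod

/-!
# Wolff's replica-pooled Γ-method statistic with POOLED-MEAN centring is consistent from EVERY family of initial laws: `V̂ᵂ_{R,n} → σ²_f` in probability

HONEST FRAMING: exact (Metropolis-corrected) sampling algorithms for lattice gauge theory;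
figures of merit are autocorrelation/cost numbers at stated couplings and volumes; no
continuum-physics claim.

Venture `LatticeQCDFlow` (cell pub-lqcd), topic `Exactness`; FANOUT row 13 (`eng-snf`, GEN-23).
NEW WORK of the cell, not a published result; no definition is introduced; nothing is cited as a
fact (U. Wolff, Comput. Phys. Commun. 156 (2004) 143, §3.3 eq. (31) — NAMED ONLY).  The probabilistic
half of `NCMCGeneralSpaceReplicaPooledMeanCentring`: for `R` independent replicas of a chain with a
Doeblin power, the per-replica sample means satisfy `√n (ȳ_r − πf) ⇒ N(0, σ²_f)` (GEN-19), so the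
path-wise bound `(1/R) Σ_r [(2W+1) δ_r² + 8C |δ_r| W²/(n−W)]` (`δ_r = ȳ_r − m̄`, `m̄` the pooled mean)
between Wolff's pooled-mean-centred window `V̂ᵂ_{R,n}` and the replica-averaged window `V̂_{R,n}`
is at most `(1/R) Σ_r [(2W+1) a_r² + 16C |a_r| W²/(n−W)]` (`a_r = ȳ_r − πf`), a replica average of
one-stream statistics that vanish in probability when `W_n → ∞`, `W_n³/n → 0` (Slutsky against the
deterministic factors `(2W_n+1)/n → 0`, `W_n²/(√n (n − W_n)) → 0`).  Hence `V̂ᵂ_{R,n} → σ²_f` in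
probability (the printed interval `m̄ ± z √(V̂ᵂ_{R,n}/(R n))` then covers `πf` with asymptotically
nominal probability exactly as for `V̂_{R,n}` — `NCMCGeneralSpaceReplicaPooledMeanCentringInterval`).

## Content (`κ` Markov, `π` invariant, `(nHit κ m)(z, ·) ≥ ε ν`, `ε ≠ 0`, `0 < m`; `|f| ≤ C`;
## `R = card ι ≥ 1` independent replicas from ANY laws `μ r`; windows `W_n → ∞`, `W_n³/n → 0`)

* `tendsto_window_div`, `tendsto_window_sq_div` — `W_n/n → 0`, `W_n²/(√n (n − W_n)) → 0`.
* `sum_sq_sub_avg_le`, `sum_abs_sub_avg_le` — `Σ_r (a_r − ā)² ≤ Σ_r a_r²`, `Σ_r |a_r − ā| ≤ 2 Σ_r |a_r|`.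
* **`chain_windowTerms_tendstoInMeasure_of_nHit`** — one stream, any start:
  `(2W_n+1)(ȳ_n − πf)² + 16C |ȳ_n − πf| W_n²/(n − W_n) → 0` in probability.
* **`pooledCentredWindow_tendstoInMeasure_of_nHit`** — `V̂ᵂ_{R,n} → σ²_f` in probability under the
  replica law, EVERY family of starts (path-wise bound of `NCMCGeneralSpaceReplicaPooledMeanCentring`
  `≤` the replica average of the window terms on `{W_n < n}`, which holds eventually; GEN-22's
  `tendstoInMeasure_zero_of_abs_le_mul` / `tendstoInMeasure_of_sub_tendstoInMeasure_zero`).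

NOT CLAIMED: Wolff's bias-correction factor and automatic window; unequal replica lengths; the
interval statement (next file); anything numerical.
-/

namespace Summit.Ventures.LatticeQCDFlow.Exactness.GeneralNCMC

open MeasureTheory ProbabilityTheory Set Filter Finset
open scoped ENNReal NNReal Topology

/-! ## §1 Window asymptotics and two finite-average inequalities -/

section Deterministic

/-- `W_n → ∞` and `W_n³/n → 0` give `W_n/n → 0`. -/
theorem tendsto_window_div {W : ℕ → ℕ} (hW : Tendsto W atTop atTop)
    (hW3 : Tendsto (fun n => (W n : ℝ) ^ 3 / n) atTop (𝓝 0)) :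
    Tendsto (fun n => (W n : ℝ) / n) atTop (𝓝 0) := by
  have h1 : ∀ᶠ n in atTop, 1 ≤ W n := hW.eventually_ge_atTop 1
  refine squeeze_zero' (Eventually.of_forall fun n => by positivity) ?_ hW3
  filter_upwards [h1] with n hn
  have hWr : (1 : ℝ) ≤ W n := by exact_mod_cast hn
  rcases Nat.eq_zero_or_pos n with hn0 | hn0
  · subst hn0; simp
  have hnr : (0 : ℝ) < n := by exact_mod_cast hn0
  rw [div_le_div_iff_of_pos_right hnr]
  calc (W n : ℝ) = (W n : ℝ) * 1 * 1 := by ring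
    _ ≤ (W n : ℝ) * W n * W n := by gcongr
    _ = (W n : ℝ) ^ 3 := by ring

/-- `W_n → ∞` and `W_n³/n → 0` give `W_n²/(√n (n − W_n)) → 0` (natural subtraction). -/
theorem tendsto_window_sq_div {W : ℕ → ℕ} (hW : Tendsto W atTop atTop)
    (hW3 : Tendsto (fun n => (W n : ℝ) ^ 3 / n) atTop (𝓝 0)) :
    Tendsto (fun n => (W n : ℝ) ^ 2 / (Real.sqrt n * ((n - W n : ℕ) : ℝ))) atTop (𝓝 0) := by
  have hdiv := tendsto_window_div hW hW3
  have h1 : ∀ᶠ n in atTop, 1 ≤ W n := hW.eventually_ge_atTop 1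
  have h2 : ∀ᶠ n in atTop, (W n : ℝ) / n < 1 / 2 := hdiv.eventually (gt_mem_nhds (by norm_num))
  have h3 : ∀ᶠ n in atTop, (W n : ℝ) ^ 3 / n < 1 := hW3.eventually (gt_mem_nhds (by norm_num))
  have hlim : Tendsto (fun n => 2 * ((W n : ℝ) / n)) atTop (𝓝 0) := by
    simpa using hdiv.const_mul 2
  refine squeeze_zero' (Eventually.of_forall fun n => by positivity) ?_ hlim
  filter_upwards [h1, h2, h3, eventually_gt_atTop 0] with n hW1 hhalf hcube hn
  have hnr : (0 : ℝ) < n := by exact_mod_cast hn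
  have hWr : (1 : ℝ) ≤ W n := by exact_mod_cast hW1
  -- `2 W ≤ n`, so `n − W ≥ n/2`
  have hWn : 2 * (W n : ℝ) < n := by
    rw [div_lt_iff₀ hnr] at hhalf; linarith
  have hWle : W n ≤ n := by exact_mod_cast (by linarith : (W n : ℝ) ≤ n)
  have hsub : ((n - W n : ℕ) : ℝ) = n - W n := by push_cast [Nat.cast_sub hWle]; ring
  have hden : (n : ℝ) / 2 ≤ ((n - W n : ℕ) : ℝ) := by rw [hsub]; linarith
  -- `W² ≤ W³ ≤ n`, so `W ≤ √n`
  have hW2n : (W n : ℝ) ^ 2 ≤ n := by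
    rw [div_lt_iff₀ hnr, one_mul] at hcube
    nlinarith
  have hWsqrt : (W n : ℝ) ≤ Real.sqrt n := Real.le_sqrt_of_sq_le hW2n
  have hsq0 : 0 < Real.sqrt n := Real.sqrt_pos.2 hnr
  -- assemble
  have hdenpos : 0 < Real.sqrt n * ((n - W n : ℕ) : ℝ) :=
    mul_pos hsq0 (lt_of_lt_of_le (by positivity) hden)
  rw [div_le_iff₀ hdenpos]
  calc (W n : ℝ) ^ 2 = W n * W n := by ring
    _ ≤ Real.sqrt n * W n := by gcongr
    _ = 2 * ((W n : ℝ) / n) * (Real.sqrt n * (n / 2)) := by field_simp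
    _ ≤ 2 * ((W n : ℝ) / n) * (Real.sqrt n * ((n - W n : ℕ) : ℝ)) := by gcongr

variable {ι : Type*} [Fintype ι]

/-- `Σ_r (a_r − ā)² ≤ Σ_r a_r²` with `ā = (Σ_r a_r)/R`. -/
theorem sum_sq_sub_avg_le (a : ι → ℝ) :
    ∑ r, (a r - (∑ r', a r') / Fintype.card ι) ^ 2 ≤ ∑ r, a r ^ 2 := by
  rcases isEmpty_or_nonempty ι with hι | hι
  · simp
  have hR : (0 : ℝ) < Fintype.card ι := by exact_mod_cast Fintype.card_pos
  set S := ∑ r', a r' with hS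
  have hexp : ∑ r, (a r - S / Fintype.card ι) ^ 2 = ∑ r, a r ^ 2 - S ^ 2 / Fintype.card ι := by
    have h1 : ∑ r, (a r - S / Fintype.card ι) ^ 2
        = ∑ r, a r ^ 2 - 2 * (S / Fintype.card ι) * ∑ r, a r
          + Fintype.card ι * (S / Fintype.card ι) ^ 2 := by
      simp only [sub_sq, sum_add_distrib, sum_sub_distrib, mul_sum, sum_const, card_univ,
        nsmul_eq_mul]
      refine congrArg₂ _ (congrArg₂ _ rfl (sum_congr rfl fun r _ => by ring)) rfl
    rw [h1, ← hS]
    field_simp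
    ring
  rw [hexp]
  have : 0 ≤ S ^ 2 / Fintype.card ι := by positivity
  linarith

/-- `Σ_r |a_r − ā| ≤ 2 Σ_r |a_r|`. -/
theorem sum_abs_sub_avg_le (a : ι → ℝ) :
    ∑ r, |a r - (∑ r', a r') / Fintype.card ι| ≤ 2 * ∑ r, |a r| := by
  rcases isEmpty_or_nonempty ι with hι | hι
  · simp
  have hR : (0 : ℝ) < Fintype.card ι := by exact_mod_cast Fintype.card_pos
  calc ∑ r, |a r - (∑ r', a r') / Fintype.card ι|
      ≤ ∑ r, (|a r| + |(∑ r', a r') / Fintype.card ι|) := sum_le_sum fun r _ => abs_sub _ _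
    _ = ∑ r, |a r| + |∑ r', a r'| := by
        rw [sum_add_distrib, sum_const, card_univ, nsmul_eq_mul, abs_div,
          abs_of_pos hR]
        field_simp
    _ ≤ ∑ r, |a r| + ∑ r', |a r'| := by gcongr; exact abs_sum_le_sum_abs _ _
    _ = 2 * ∑ r, |a r| := by ring

end Deterministic

/-! ## §2 One stream: the window terms vanish in probability -/

section Chain

variable {S : Type*} [MeasurableSpace S]
  {κ : Kernel S S} [IsMarkovKernel κ] {π : Measure S} [IsProbabilityMeasure π]
  {ν : Measure S} [IsProbabilityMeasure ν] {ε : ℝ≥0∞} {m : ℕ}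

/-- **One stream, any start**: with `a_n = (Σ_{i<n} f(x_i))/n − πf`, windows `W_n → ∞`, `W_n³/n → 0`:
`4(2W_n + 1) a_n² + 16C |a_n| W_n²/(n − W_n) → 0` in `P_{μ₀}`-probability. -/
theorem chain_windowTerms_tendstoInMeasure_of_nHit (hπ : Kernel.Invariant κ π) (hε : ε ≠ 0)
    (hmin : ∀ z, ε • ν ≤ nHit κ m z) (hm : 0 < m)
    {f : S → ℝ} (hf : Measurable f) {C : ℝ} (hC : ∀ x, |f x| ≤ C)
    {W : ℕ → ℕ} (hW : Tendsto W atTop atTop) (hW3 : Tendsto (fun N => (W N : ℝ) ^ 3 / N) atTop (𝓝 0))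
    (μ₀ : Measure S) [IsProbabilityMeasure μ₀]
    [IsProbabilityMeasure (Kernel.trajMeasure (X := fun _ : ℕ => S) μ₀
        (fun n : ℕ => κ.comap (fun hh : (i : ↥(Finset.Iic n)) → S => hh ⟨n, Finset.mem_Iic.2 le_rfl⟩)
          (measurable_pi_apply _)))] :
    TendstoInMeasure (Kernel.trajMeasure (X := fun _ : ℕ => S) μ₀
        (fun n : ℕ => κ.comap (fun hh : (i : ↥(Finset.Iic n)) → S => hh ⟨n, Finset.mem_Iic.2 le_rfl⟩)
          (measurable_pi_apply _)))
      (fun (n : ℕ) (x : ℕ → S) =>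
        4 * (2 * (W n : ℝ) + 1) * ((∑ i ∈ range n, f (x i)) / n - ∫ z, f z ∂π) ^ 2
          + 16 * C * |(∑ i ∈ range n, f (x i)) / n - ∫ z, f z ∂π| * (W n : ℝ) ^ 2
            / ((n - W n : ℕ) : ℝ))
      atTop (fun _ => 0) := by
  -- the CLT: `X_n = (√n)⁻¹ Σ (f − πf) ⇒ N(0, σ²)` (obtained before naming the law: `set` is definitional)
  have hclt := tendstoInDistribution_timeAverage_id_of_nHit hπ hε hmin hm hf hC μ₀
  set P := Kernel.trajMeasure (X := fun _ : ℕ => S) μ₀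
    (fun n : ℕ => κ.comap (fun hh : (i : ↥(Finset.Iic n)) → S => hh ⟨n, Finset.mem_Iic.2 le_rfl⟩)
      (measurable_pi_apply _)) with hP
  have ham : ∀ n, Measurable fun x : ℕ → S => (∑ i ∈ range n, f (x i)) / n - ∫ z, f z ∂π := fun n =>
    ((Finset.measurable_sum _ fun i _ => hf.comp (measurable_pi_apply i)).div_const _).sub
      measurable_const
  -- the deterministic factors, as convergences in probability to `0`
  have c1 : Tendsto (fun n => Real.sqrt ((2 * (W n : ℝ) + 1) / n)) atTop (𝓝 0) := by
    have h : Tendsto (fun n => (2 * (W n : ℝ) + 1) / n) atTop (𝓝 0) := by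
      have h2 := (tendsto_window_div hW hW3).const_mul 2
      have h3 : Tendsto (fun n : ℕ => (1 : ℝ) / n) atTop (𝓝 0) := tendsto_one_div_atTop_nhds_zero_nat
      have := h2.add h3
      simp only [mul_zero, zero_add] at this
      refine this.congr fun n => ?_
      ring
    have := (Real.continuous_sqrt.tendsto 0).comp h
    rwa [Real.sqrt_zero] at this
  have c2 := tendsto_window_sq_div hW hW3
  have hc1 : TendstoInMeasure P (fun (n : ℕ) (_ : ℕ → S) => Real.sqrt ((2 * (W n : ℝ) + 1) / n)) atTop
      (fun _ => (0 : ℝ)) :=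
    tendstoInMeasure_of_tendsto_ae (fun n => aestronglyMeasurable_const) (Eventually.of_forall fun _ => c1)
  have hc2 : TendstoInMeasure P (fun (n : ℕ) (_ : ℕ → S) =>
      (W n : ℝ) ^ 2 / (Real.sqrt n * ((n - W n : ℕ) : ℝ))) atTop (fun _ => (0 : ℝ)) :=
    tendstoInMeasure_of_tendsto_ae (fun n => aestronglyMeasurable_const) (Eventually.of_forall fun _ => c2)
  -- Slutsky, first term: `(X_n · c1_n)² ⇒ (Z·0)² = 0`
  have hT1 := hclt.continuous_comp_prodMk_of_tendstoInMeasure_const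
    (g := fun p : ℝ × ℝ => 4 * (p.1 * p.2) ^ 2) (by fun_prop) hc1 (fun n => aemeasurable_const)
  have hT1' := Scoring.CardConsistency.tendstoInMeasure_of_tendstoInDistribution_const
    (hT1.congr (T := fun _ => (0 : ℝ)) (fun n => Filter.EventuallyEq.rfl)
      (Eventually.of_forall fun ω' => by simp))
  -- Slutsky, second term: `16 C |X_n · c2_n| ⇒ 0`
  have hT2 := hclt.continuous_comp_prodMk_of_tendstoInMeasure_const
    (g := fun p : ℝ × ℝ => 16 * C * |p.1 * p.2|) (by fun_prop) hc2 (fun n => aemeasurable_const)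
  have hT2' := Scoring.CardConsistency.tendstoInMeasure_of_tendstoInDistribution_const
    (hT2.congr (T := fun _ => (0 : ℝ)) (fun n => Filter.EventuallyEq.rfl)
      (Eventually.of_forall fun ω' => by simp))
  -- add, and identify with the target for `n ≥ 1`
  have hsum := tendstoInMeasure_sum_const (μ := P) ({0, 1} : Finset (Fin 2))
    (T := fun j n (x : ℕ → S) => if j = 0 then
        4 * (((Real.sqrt n)⁻¹ * ∑ t ∈ range n, (f (x t) - ∫ z, f z ∂π))
          * Real.sqrt ((2 * (W n : ℝ) + 1) / n)) ^ 2
      else 16 * C * |((Real.sqrt n)⁻¹ * ∑ t ∈ range n, (f (x t) - ∫ z, f z ∂π))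
          * ((W n : ℝ) ^ 2 / (Real.sqrt n * ((n - W n : ℕ) : ℝ)))|)
    (c := fun _ => 0) (by
      intro j hj
      fin_cases j
      · simpa using hT1'
      · simpa using hT2')
  simp only [Finset.sum_pair (show (0 : Fin 2) ≠ 1 by decide), Fin.isValue,
    ↓reduceIte, one_ne_zero, add_zero] at hsum
  refine hsum.congr' ?_ Filter.EventuallyEq.rfl
  filter_upwards [eventually_gt_atTop 0] with n hn
  refine Eventually.of_forall fun x => ?_
  dsimp only
  have hnr : (0 : ℝ) < n := by exact_mod_cast hn
  have hs : Real.sqrt n ≠ 0 := (Real.sqrt_pos.2 hnr).ne'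
  have hsq : Real.sqrt n * Real.sqrt n = n := Real.mul_self_sqrt hnr.le
  have hX : (Real.sqrt n)⁻¹ * ∑ t ∈ range n, (f (x t) - ∫ z, f z ∂π)
      = Real.sqrt n * ((∑ i ∈ range n, f (x i)) / n - ∫ z, f z ∂π) :=
    (sqrt_mul_mean_sub_eq (fun i => f (x i)) _ n).symm
  set a := (∑ i ∈ range n, f (x i)) / n - ∫ z, f z ∂π with ha
  rw [hX]
  have h21 : 0 ≤ (2 * (W n : ℝ) + 1) / n := by positivity
  have hterm1 : (Real.sqrt n * a * Real.sqrt ((2 * (W n : ℝ) + 1) / n)) ^ 2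
      = (2 * (W n : ℝ) + 1) * a ^ 2 := by
    rw [mul_pow, mul_pow, Real.sq_sqrt h21, Real.sq_sqrt hnr.le]
    field_simp
  have hterm2 : |Real.sqrt n * a * ((W n : ℝ) ^ 2 / (Real.sqrt n * ((n - W n : ℕ) : ℝ)))|
      = |a| * (W n : ℝ) ^ 2 / ((n - W n : ℕ) : ℝ) := by
    rcases Nat.eq_zero_or_pos (n - W n) with h0 | hpos
    · rw [h0]; simp
    have hd : (0 : ℝ) < ((n - W n : ℕ) : ℝ) := by exact_mod_cast hpos
    rw [show Real.sqrt n * a * ((W n : ℝ) ^ 2 / (Real.sqrt n * ((n - W n : ℕ) : ℝ)))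
        = a * ((W n : ℝ) ^ 2 / ((n - W n : ℕ) : ℝ)) by field_simp, abs_mul,
      abs_of_nonneg (by positivity : (0 : ℝ) ≤ (W n : ℝ) ^ 2 / ((n - W n : ℕ) : ℝ))]
    ring
  rw [hterm1, hterm2]
  ring

end Chain

/-! ## §3 The replica law: Wolff's pooled-mean-centred statistic is consistent -/

section Pooled

variable {S : Type*} [MeasurableSpace S]
  {κ : Kernel S S} [IsMarkovKernel κ] {π : Measure S} [IsProbabilityMeasure π]
  {ν : Measure S} [IsProbabilityMeasure ν] {ε : ℝ≥0∞} {m : ℕ}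
  {ι : Type*} [Fintype ι] [Nonempty ι]

/-- **WOLFF'S REPLICA-POOLED Γ-METHOD STATISTIC (POOLED-MEAN CENTRING) IS CONSISTENT, EVERY FAMILY OF
STARTS.**  `κ` Markov, `π` invariant, `(nHit κ m)(z, ·) ≥ ε ν` (`ε ≠ 0`, `0 < m`), `|f| ≤ C`; windows
`W_n → ∞`, `W_n³/n → 0`; `R = card ι` independent replicas from ANY laws `μ r`; pooled mean
`m̄ = (Σ_r Σ_{i<n} f(x^r_i))/(R n)`.  Then
`V̂ᵂ_{R,n} = (1/R) Σ_r [Σ_{i<n}(f(x^r_i) − m̄)²/n + 2 Σ_{t=1}^{W_n} Σ_{i<n−t}(f(x^r_i) − m̄)(f(x^r_{i+t}) − m̄)/(n − t)] → σ²_f`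
in probability under the replica law. -/
theorem pooledCentredWindow_tendstoInMeasure_of_nHit (hπ : Kernel.Invariant κ π) (hε : ε ≠ 0)
    (hmin : ∀ z, ε • ν ≤ nHit κ m z) (hm : 0 < m)
    {f : S → ℝ} (hf : Measurable f) {C : ℝ} (hC : ∀ x, |f x| ≤ C)
    {W : ℕ → ℕ} (hW : Tendsto W atTop atTop) (hW3 : Tendsto (fun N => (W N : ℝ) ^ 3 / N) atTop (𝓝 0))
    (μ : ι → Measure S) [∀ r, IsProbabilityMeasure (μ r)]
    [∀ r, IsProbabilityMeasure (Kernel.trajMeasure (X := fun _ : ℕ => S) (μ r)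
        (fun n : ℕ => κ.comap (fun hh : (i : ↥(Finset.Iic n)) → S => hh ⟨n, Finset.mem_Iic.2 le_rfl⟩)
          (measurable_pi_apply _)))] :
    TendstoInMeasure (Measure.pi fun r => Kernel.trajMeasure (X := fun _ : ℕ => S) (μ r)
        (fun n : ℕ => κ.comap (fun hh : (i : ↥(Finset.Iic n)) → S => hh ⟨n, Finset.mem_Iic.2 le_rfl⟩)
          (measurable_pi_apply _)))
      (fun (n : ℕ) (x : ι → ℕ → S) =>
        (∑ r, (Scoring.lagSum (fun i => f (x r i)
              - (∑ r', ∑ i ∈ range n, f (x r' i)) / ((Fintype.card ι : ℝ) * n)) n 0 / ((n - 0 : ℕ) : ℝ)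
          + 2 * ∑ t ∈ range (W n), Scoring.lagSum (fun i => f (x r i)
              - (∑ r', ∑ i ∈ range n, f (x r' i)) / ((Fintype.card ι : ℝ) * n)) n (t + 1)
                / ((n - (t + 1) : ℕ) : ℝ))) / Fintype.card ι)
      atTop (fun _ => Scoring.autocov κ π (fun y => f y - ∫ z, f z ∂π) 0
        + 2 * ∑' t, Scoring.autocov κ π (fun y => f y - ∫ z, f z ∂π) (t + 1)) := by
  have hC0 : 0 ≤ C := (abs_nonneg _).trans (hC (Classical.choice (nonempty_of_isProbabilityMeasure π)))
  have hR : (0 : ℝ) < Fintype.card ι := by exact_mod_cast Fintype.card_pos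
  -- the replica-averaged window is consistent (GEN-23 R3)
  have hV := pooledGammaWindow_tendstoInMeasure_of_nHit hπ hε hmin hm hf hC hW hW3 μ
  -- the per-replica window terms vanish; average them over the replicas
  have hT := tendstoInMeasure_pi_avg
    (P := fun r => Kernel.trajMeasure (X := fun _ : ℕ => S) (μ r)
      (fun n : ℕ => κ.comap (fun hh : (i : ↥(Finset.Iic n)) → S => hh ⟨n, Finset.mem_Iic.2 le_rfl⟩)
        (measurable_pi_apply _)))
    (T := fun (_r : ι) (n : ℕ) (x : ℕ → S) =>
      4 * (2 * (W n : ℝ) + 1) * ((∑ i ∈ range n, f (x i)) / n - ∫ z, f z ∂π) ^ 2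
        + 16 * C * |(∑ i ∈ range n, f (x i)) / n - ∫ z, f z ∂π| * (W n : ℝ) ^ 2 / ((n - W n : ℕ) : ℝ))
    (fun _ n => by
      have ha : Measurable fun x : ℕ → S => (∑ i ∈ range n, f (x i)) / n - ∫ z, f z ∂π :=
        ((Finset.measurable_sum _ fun i _ => hf.comp (measurable_pi_apply i)).div_const _).sub
          measurable_const
      exact ((measurable_const.mul (ha.pow_const 2)).add
        (((measurable_const.mul (ha.abs)).mul measurable_const).div_const _)))
    (fun r => chain_windowTerms_tendstoInMeasure_of_nHit hπ hε hmin hm hf hC hW hW3 (μ r))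
  -- name the law and the three statistics
  set P := Measure.pi fun r => Kernel.trajMeasure (X := fun _ : ℕ => S) (μ r)
    (fun n : ℕ => κ.comap (fun hh : (i : ↥(Finset.Iic n)) → S => hh ⟨n, Finset.mem_Iic.2 le_rfl⟩)
      (measurable_pi_apply _)) with hP
  set Vw : ℕ → (ι → ℕ → S) → ℝ := fun n x =>
    (∑ r, (Scoring.lagSum (fun i => f (x r i)
          - (∑ r', ∑ i ∈ range n, f (x r' i)) / ((Fintype.card ι : ℝ) * n)) n 0 / ((n - 0 : ℕ) : ℝ)
      + 2 * ∑ t ∈ range (W n), Scoring.lagSum (fun i => f (x r i)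
          - (∑ r', ∑ i ∈ range n, f (x r' i)) / ((Fintype.card ι : ℝ) * n)) n (t + 1)
            / ((n - (t + 1) : ℕ) : ℝ))) / Fintype.card ι with hVw
  set V : ℕ → (ι → ℕ → S) → ℝ := fun n x => (∑ r, Scoring.gammaHat (fun i => f (x r i)) n 0
    * (2 * Scoring.tauIntWindow (Scoring.rhoHat (fun i => f (x r i)) n) (W n))) / Fintype.card ι
    with hVdef
  set T : ℕ → (ι → ℕ → S) → ℝ := fun n x => (∑ r,
      (4 * (2 * (W n : ℝ) + 1) * ((∑ i ∈ range n, f (x r i)) / n - ∫ z, f z ∂π) ^ 2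
        + 16 * C * |(∑ i ∈ range n, f (x r i)) / n - ∫ z, f z ∂π| * (W n : ℝ) ^ 2
          / ((n - W n : ℕ) : ℝ))) / Fintype.card ι with hTdef
  -- the path-wise bound on `{W_n < n}`
  have hbound : ∀ n, W n < n → ∀ x : ι → ℕ → S, |Vw n x - V n x| ≤ T n x := by
    intro n hWn x
    have hn : 0 < n := lt_of_le_of_lt (Nat.zero_le _) hWn
    have hnr : (0 : ℝ) < n := by exact_mod_cast hn
    have hy : ∀ r, ∀ i < n, |f (x r i)| ≤ C := fun r i _ => hC _
    have h1 := abs_pooledCentredWindow_sub_pooledGammaWindow_le (y := fun r i => f (x r i)) hC0 hy hWn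
    refine h1.trans (div_le_div_of_nonneg_right ?_ hR.le)
    -- `δ_r = a_r − ā` with `a_r = ȳ_r − πf`
    have hmean : ∀ r, Scoring.sampleMean (fun i => f (x r i)) n
        - (∑ r', ∑ i ∈ range n, f (x r' i)) / ((Fintype.card ι : ℝ) * n)
        = ((∑ i ∈ range n, f (x r i)) / n - ∫ z, f z ∂π)
          - (∑ r', ((∑ i ∈ range n, f (x r' i)) / n - ∫ z, f z ∂π)) / Fintype.card ι := by
      intro r
      unfold Scoring.sampleMean
      rw [Finset.sum_sub_distrib, Finset.sum_const, Finset.card_univ, nsmul_eq_mul, ← Finset.sum_div]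
      field_simp
      ring
    simp_rw [hmean]
    set a : ι → ℝ := fun r => (∑ i ∈ range n, f (x r i)) / n - ∫ z, f z ∂π with ha
    have hWfac : 0 ≤ (W n : ℝ) ^ 2 / ((n - W n : ℕ) : ℝ) := by positivity
    have hsq := sum_sq_sub_avg_le a
    have habs := sum_abs_sub_avg_le a
    calc ∑ r, ((2 * (W n : ℝ) + 1) * (a r - (∑ r', a r') / Fintype.card ι) ^ 2
            + 8 * C * |a r - (∑ r', a r') / Fintype.card ι| * (W n : ℝ) ^ 2 / ((n - W n : ℕ) : ℝ))
        = (2 * (W n : ℝ) + 1) * ∑ r, (a r - (∑ r', a r') / Fintype.card ι) ^ 2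
          + 8 * C * ((W n : ℝ) ^ 2 / ((n - W n : ℕ) : ℝ))
            * ∑ r, |a r - (∑ r', a r') / Fintype.card ι| := by
          rw [Finset.sum_add_distrib, Finset.mul_sum, Finset.mul_sum]
          refine congrArg₂ (· + ·) rfl (Finset.sum_congr rfl fun r _ => by ring)
      _ ≤ (2 * (W n : ℝ) + 1) * ∑ r, a r ^ 2
          + 8 * C * ((W n : ℝ) ^ 2 / ((n - W n : ℕ) : ℝ)) * (2 * ∑ r, |a r|) := by
          gcongr
      _ ≤ 4 * (2 * (W n : ℝ) + 1) * ∑ r, a r ^ 2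
          + 8 * C * ((W n : ℝ) ^ 2 / ((n - W n : ℕ) : ℝ)) * (2 * ∑ r, |a r|) := by
          have : 0 ≤ (2 * (W n : ℝ) + 1) * ∑ r, a r ^ 2 :=
            mul_nonneg (by positivity) (Finset.sum_nonneg fun r _ => sq_nonneg _)
          linarith
      _ = ∑ r, (4 * (2 * (W n : ℝ) + 1) * a r ^ 2
          + 16 * C * |a r| * (W n : ℝ) ^ 2 / ((n - W n : ℕ) : ℝ)) := by
          rw [Finset.sum_add_distrib, Finset.mul_sum, Finset.mul_sum, Finset.mul_sum]
          refine congrArg₂ (· + ·) rfl (Finset.sum_congr rfl fun r _ => by ring)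
  -- the truncated bound sequence `T'` (equal to `T` once `W_n < n`) dominates `|Vw − V|` everywhere
  have hev : ∀ᶠ n in atTop, W n < n := by
    have h := (tendsto_window_div hW hW3).eventually (gt_mem_nhds (by norm_num : (0 : ℝ) < 1))
    filter_upwards [h, eventually_gt_atTop 0] with n hn hn0
    have hnr : (0 : ℝ) < n := by exact_mod_cast hn0
    have : (W n : ℝ) < n := by rwa [div_lt_iff₀ hnr, one_mul] at hn
    exact_mod_cast this
  classical
  set T' : ℕ → (ι → ℕ → S) → ℝ := fun n x => if W n < n then T n x else |Vw n x - V n x| with hT'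
  have hT'conv : TendstoInMeasure P T' atTop (fun _ => (0 : ℝ)) := by
    refine hT.congr' ?_ Filter.EventuallyEq.rfl
    filter_upwards [hev] with n hn
    exact Eventually.of_forall fun x => by simp [hT', hn, hTdef]
  have hdom : ∀ n x, |(Vw n x - V n x)| ≤ 1 * |T' n x| := by
    intro n x
    rw [one_mul]
    by_cases hn : W n < n
    · rw [show T' n x = T n x by simp [hT', hn]]
      exact (hbound n hn x).trans (le_abs_self _)
    · rw [show T' n x = |Vw n x - V n x| by simp [hT', hn], abs_abs]
  have hD := tendstoInMeasure_zero_of_abs_le_mul hT'conv one_pos hdom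
  exact tendstoInMeasure_of_sub_tendstoInMeasure_zero hV hD

end Pooled

end Summit.Ventures.LatticeQCDFlow.Exactness.GeneralNCMC
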